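import Literature.AnabelianGeometry.SemiGraphs.TemperedCurveGroupLevelDataNonVacuity2
import Literature.AnabelianGeometry.SemiGraphs.TemperedOrigin
import HarnessLib

/-!
# The saturated-cusp `F̂₂` datum WITH ITS FRAME: an explicit `F̂₂ ≃ₜ* Δ^temp` and a retraction
# `Π^temp → Δ^temp` ([SemiAnbd] §6 p. 71; sequel of `TemperedCuspidalAbsolutenessLeafCuspedNonVacuity.lean`)

Mochizuki, *Semi-graphs of anabelioids*, Publ. RIMS **42** (2006) [SemiAnbd], §6 p. 71 («`I_x = D_x ∩ Δ^temp_X` is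
isomorphic to `Ẑ(1)` … if `x` is a cusp»), Thm. 6.5 (iii) p. 72, Ex. 3.10 p. 44 [cite: MochizukiSemiAnbd2006, §6 p.71].

PROOF-ONLY non-vacuity file (abc-iut cell, layer L3, seat abc-iut-L3-t11 gen 6, step (B4c) of the row
«NV-hLG@cusped» / «CUSP-ABS·NONDEGENERATE-NV»; no definition, no instance, no named fact).  The cusped datum of
`TemperedCurve.exists_saturatedCusps` (p472030: `K = ℚ_p`, `Π^temp = G_{ℚ_p} × F̂₂`, cusps = all automorphism
translates `φ(îa(Ẑ))`) is re-exported here TOGETHER WITH ITS FRAME, which the assembly of the levelwise cusp–graph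
binder `hLG` over it needs and which an existential over `X` alone cannot recover:

* `TemperedCurve.exists_saturatedCusps_framed` — the same `X` with an explicit isomorphism of topological groups
  `e : F̂₂ ≃ₜ* Δ^temp_X` (`z ↦ (1, z)`), a RETRACTION `r : Π^temp_X →* Δ^temp_X` (`(σ, z) ↦ (1, z)`, identity on
  `Δ^temp_X`), a cusp, all points cusps, closed inertia groups, and the SATURATION law
  `γ(I_x ∩ Δ^temp) = I_y ∩ Δ^temp`.

Consistency evidence for the interface only (no curve); same honest limits as p472030.  Nothing of [SemiAnbd] is
asserted; no side is taken on [IUTchIII] Cor. 3.12.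
-/

noncomputable section

open Topology Filter Set Function
open scoped Pointwise
open Literature.IUT.HodgeTheaters (profiniteCompletion toCompletion toCompletion_int_injective)
open Literature.AlgebraicGeometry.Frobenioids (IsSlimGroup)
open Literature.AnabelianGeometry.AbsoluteAnabelian

namespace Literature.AnabelianGeometry.SemiGraphs

namespace TemperedCurve

/-- **The saturated-cusp `F̂₂` datum with its frame**: a `TemperedCurve p` with `Π^temp = G_{ℚ_p} × F̂₂` and the
automorphism-saturated cusp set (as in `exists_saturatedCusps`), TOGETHER WITH `e : F̂₂ ≃ₜ* Δ^temp` (`z ↦ (1,z)`), a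
retraction `r : Π^temp →* Δ^temp` fixing `Δ^temp` pointwise, a cusp (all points are cusps), closed inertia groups,
and the saturation law `∀ γ x, ∃ y, γ(I_x ∩ Δ^temp) = I_y ∩ Δ^temp`.  Consistency evidence only (no curve).
[cite: MochizukiSemiAnbd2006, §6 p.71] -/
theorem exists_saturatedCusps_framed (p : ℕ) [Fact p.Prime] :
    ∃ (X : TemperedCurve p) (r : X.PiTemp →* X.DeltaTemp),
      Nonempty (profiniteCompletion (FreeGroup (Fin 2)) ≃ₜ* X.DeltaTemp) ∧
      (∀ g : X.DeltaTemp, r g = g) ∧ Nonempty X.Pt ∧ (∀ x : X.Pt, X.IsCusp x) ∧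
      (∀ x : X.Pt, IsClosed ((X.inertia x : Subgroup X.PiTemp) : Set X.PiTemp)) ∧
      ∀ γ : X.DeltaTemp ≃ₜ* X.DeltaTemp, ∀ x : X.Pt, ∃ y : X.Pt,
        ((X.inertia x).subgroupOf X.DeltaTemp).map γ.toMulEquiv.toMonoidHom =
          (X.inertia y).subgroupOf X.DeltaTemp := by
  classical
  -- instances on `G_{ℚ_p}`
  haveI : IsGalois ℚ_[p] (AlgebraicClosure ℚ_[p]) := {}
  haveI : T2Space (GQp p) := krullTopology_t2
  -- the profinite data (abc-iut-w5-d218's toolkit, as in abc-iut-w5-d040's witness)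
  let P : ProfiniteGrp.{0} := profiniteCompletion (FreeGroup (Fin 2))
  let Zh : ProfiniteGrp.{0} := profiniteCompletion (Multiplicative ℤ)
  let η : FreeGroup (Fin 2) →* P := toCompletion (FreeGroup (Fin 2))
  let ι : Multiplicative ℤ →* Zh := toCompletion (Multiplicative ℤ)
  let a : FreeGroup (Fin 2) := FreeGroup.of 0
  let b : FreeGroup (Fin 2) := FreeGroup.of 1
  let σa : FreeGroup (Fin 2) →* Multiplicative ℤ :=
    FreeGroup.lift fun j => if j = (0 : Fin 2) then Multiplicative.ofAdd (1 : ℤ) else 1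
  have hσaa : σa a = Multiplicative.ofAdd 1 := by simp [σa, a]
  have hσab : σa b = 1 := by simp [σa, b]
  let e : P →ₜ* Zh := (ProfiniteGrp.ProfiniteCompletion.lift (GrpCat.ofHom (ι.comp σa))).hom
  let îa : Zh →ₜ* P :=
    (ProfiniteGrp.ProfiniteCompletion.lift (GrpCat.ofHom (η.comp (zpowersHom _ a)))).hom
  let îb : Zh →ₜ* P :=
    (ProfiniteGrp.ProfiniteCompletion.lift (GrpCat.ofHom (η.comp (zpowersHom _ b)))).hom
  have he : ∀ g, e (η g) = ι (σa g) := fun g => lift_hom_toCompletion Zh (ι.comp σa) g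
  have hîa : ∀ k : ℤ, îa (ι (Multiplicative.ofAdd k)) = η (a ^ k) := fun k => by
    rw [lift_hom_toCompletion P (η.comp (zpowersHom _ a))]
    simp [zpowersHom_apply]
  have hîb : ∀ k : ℤ, îb (ι (Multiplicative.ofAdd k)) = η (b ^ k) := fun k => by
    rw [lift_hom_toCompletion P (η.comp (zpowersHom _ b))]
    simp [zpowersHom_apply]
  have heîa : ∀ t, e (îa t) = t := TemperedFibreProduct.apply_apply_eq_self_of a σa hσaa e îa he hîa
  have hιinj : Function.Injective ι := toCompletion_int_injective
  -- `η a` and `η b` do not commute: else `η a ∈ C(η b) ⊆ îb(Ẑ)`, and `e` kills `îb(Ẑ)` but not `η a`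
  have hnc : η a * η b ≠ η b * η a := by
    intro hab
    have hz' : η a ∈ Subgroup.centralizer ({η (b ^ (1 : ℤ))} : Set P) := by
      rw [zpow_one]; exact Subgroup.mem_centralizer_singleton_iff.mpr hab
    obtain ⟨t, ht⟩ := TemperedFibreProduct.closure_eta_zpowers_subset_range b îb hîb
      (TemperedFibreProduct.centralizer_eta_of_zpow_subset 1 one_ne_zero hz')
    have h1 : e (η a) = ι (Multiplicative.ofAdd 1) := by rw [he, hσaa]
    have h2 : e (η a) = 1 := by
      rw [← ht]; exact TemperedFibreProduct.apply_apply_eq_one_of b σa hσab e îb he hîb t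
    rw [h1, ← map_one ι] at h2
    exact absurd (hιinj h2) (by decide)
  -- `η b ∉ îa(Ẑ)`: `e` is the identity on `îa(Ẑ)` and kills `η b ≠ 1`
  have hηb_ne : η b ≠ 1 := by
    intro h1
    exact hnc (by rw [h1, mul_one, one_mul])
  -- the inertia `I := îa(Ẑ)`, closed
  let I : Subgroup P := îa.toMonoidHom.range
  have hIclosed : IsClosed (I : Set P) := by
    have : (I : Set P) = Set.range îa := by ext x; simp [I]
    rw [this]; exact (isCompact_range îa.continuous).isClosed
  have hηb_notMem : η b ∉ I := by
    rintro ⟨t, ht⟩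
    have h1 : e (η b) = 1 := by rw [he, hσab, map_one]
    have h2 : e (îa t) = t := heîa t
    have h3 : (îa.toMonoidHom t : P) = îa t := rfl
    rw [h3] at ht
    rw [ht] at h2
    rw [h1] at h2
    apply hηb_ne
    rw [← ht, ← h2, map_one]
  -- the group `Π := G_{ℚ_p} × F̂₂`; for `φ : F̂₂ ≃ₜ* F̂₂` the decomposition group `D_φ := G_{ℚ_p} × φ(I)`
  let D : (P ≃ₜ* P) → Subgroup (GQp p × P) := fun φ =>
    (⊤ : Subgroup (GQp p)).prod (I.comap φ.symm.toMulEquiv.toMonoidHom)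
  have hDmem : ∀ (φ : P ≃ₜ* P) (x : GQp p × P), x ∈ D φ ↔ φ.symm x.2 ∈ I := fun φ x => by
    change x ∈ (⊤ : Subgroup (GQp p)).prod (I.comap φ.symm.toMulEquiv.toMonoidHom) ↔ _
    rw [Subgroup.mem_prod, Subgroup.mem_comap]
    exact ⟨fun h => h.2, fun h => ⟨Subgroup.mem_top _, h⟩⟩
  have hDclosed : ∀ φ : P ≃ₜ* P, IsClosed (D φ : Set (GQp p × P)) := fun φ => by
    have : (D φ : Set (GQp p × P)) = (fun x : GQp p × P => φ.symm x.2) ⁻¹' (I : Set P) := by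
      ext x; exact hDmem φ x
    rw [this]; exact hIclosed.preimage (φ.symm.continuous.comp continuous_snd)
  let fstH : GQp p × P →ₜ* GQp p := ContinuousMonoidHom.fst _ _
  have hfstD : ∀ φ : P ≃ₜ* P, fstH '' (D φ : Set (GQp p × P)) = Set.univ := fun φ =>
    Set.eq_univ_of_forall fun g => ⟨(g, 1), (hDmem φ _).2 (by
      change φ.symm 1 ∈ I
      rw [map_one]; exact I.one_mem), rfl⟩
  -- the inertia `D_φ ∩ Ker(pr₁) = 1 × φ(îa(Ẑ)) ≃ₜ* Ẑ` via `ê_a ∘ φ⁻¹`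
  have hinertia : ∀ φ : P ≃ₜ* P, Nonempty (↥(D φ ⊓ fstH.toMonoidHom.ker) ≃ₜ* ZHat) := fun φ => by
    refine ⟨{ toFun := fun x => e (φ.symm x.1.2)
              invFun := fun t => ⟨(1, φ (îa t)), (hDmem φ _).2 (by
                  rw [ContinuousMulEquiv.symm_apply_apply]; exact ⟨t, rfl⟩), (MonoidHom.mem_ker).2 rfl⟩
              left_inv := fun x => ?_
              right_inv := fun t => by
                change e (φ.symm (φ (îa t))) = t
                rw [ContinuousMulEquiv.symm_apply_apply]; exact heîa t
              map_mul' := fun x y => by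
                change e (φ.symm ((x : GQp p × P) * y).2) =
                  e (φ.symm (x : GQp p × P).2) * e (φ.symm (y : GQp p × P).2)
                rw [Prod.snd_mul, map_mul, map_mul]
              continuous_toFun :=
                e.continuous.comp (φ.symm.continuous.comp (continuous_snd.comp continuous_subtype_val))
              continuous_invFun :=
                (continuous_const.prodMk (φ.continuous.comp îa.continuous)).subtype_mk _ }⟩
    obtain ⟨⟨g, z⟩, hgz⟩ := x
    have hg : g = 1 := (MonoidHom.mem_ker).1 (Subgroup.mem_inf.1 hgz).2
    obtain ⟨u, hu⟩ : φ.symm z ∈ I := (hDmem φ _).1 (Subgroup.mem_inf.1 hgz).1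
    apply Subtype.ext
    change ((1 : GQp p), φ (îa (e (φ.symm z)))) = (g, z)
    have hu' : îa u = φ.symm z := hu
    rw [hg, ← hu', heîa u, hu', ContinuousMulEquiv.apply_symm_apply]
  -- the curve-level datum
  let X : TemperedCurve p :=
    { K := ⊥
      finiteDimensional_K := inferInstance
      PiTemp := GQp p × P
      aug := fstH
      range_aug := by
        rw [IntermediateField.fixingSubgroup_bot]
        exact MonoidHom.range_eq_top.mpr Prod.fst_surjective
      PiHat := GQp p × P
      toHat := ContinuousMonoidHom.id _
      isProfiniteCompletion_toHat := isProfiniteCompletion_id _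
      toHat_injective := Function.injective_id
      augHat := fstH
      augHat_comp := fun _ => rfl
      Pt := P ≃ₜ* P
      IsCusp := fun _ => True
      decomp := D
      isClosed_decomp := hDclosed
      isOpen_aug_decomp := fun φ => by
        change IsOpen (fstH '' (D φ : Set (GQp p × P)))
        rw [hfstD]; exact isOpen_univ
      inertia_eq_bot := fun _ h => (h trivial).elim
      inertia_equiv_zHat := fun φ _ => hinertia φ }
  -- group-level facts about `Π = G_{ℚ_p} × F̂₂`
  -- `Δ^temp = Ker(pr₁) = 1 × F̂₂ ≃ₜ* F̂₂`, with an EXPLICIT transport `eΔ`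
  have hΔmem : ∀ x : GQp p × P, x ∈ X.DeltaTemp ↔ x.1 = 1 := fun x => MonoidHom.mem_ker
  let eΔ : P ≃ₜ* X.DeltaTemp :=
    { toFun := fun z => ⟨(1, z), (hΔmem _).2 rfl⟩
      invFun := fun y => y.1.2
      left_inv := fun z => rfl
      right_inv := fun y => by
        apply Subtype.ext
        exact Prod.ext ((hΔmem _).1 y.2).symm rfl
      map_mul' := fun z w => Subtype.ext (Prod.ext (mul_one _).symm rfl)
      continuous_toFun := (continuous_const.prodMk continuous_id).subtype_mk _
      continuous_invFun := continuous_snd.comp continuous_subtype_val }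
  -- membership in the inertia groups, read on `Δ^temp`
  have hImem : ∀ (φ : P ≃ₜ* P) (w : X.DeltaTemp),
      (w : GQp p × P) ∈ X.inertia φ ↔ φ.symm (w : GQp p × P).2 ∈ I := fun φ w => by
    change (w : GQp p × P) ∈ D φ ⊓ X.DeltaTemp ↔ _
    rw [Subgroup.mem_inf, hDmem]
    exact ⟨fun h => h.1, fun h => ⟨h, w.2⟩⟩
  -- the retraction `r : Π^temp → Δ^temp`, `(σ, z) ↦ (1, z)`
  let r : (GQp p × P) →* X.DeltaTemp :=
    { toFun := fun x => ⟨(1, x.2), (hΔmem _).2 rfl⟩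
      map_one' := Subtype.ext rfl
      map_mul' := fun x y => Subtype.ext (Prod.ext (mul_one _).symm rfl) }
  have hr : ∀ g : X.DeltaTemp, r g = g := fun g => by
    apply Subtype.ext
    change ((1 : GQp p), (g : GQp p × P).2) = (g : GQp p × P)
    exact Prod.ext ((hΔmem _).1 g.2).symm rfl
  have hIclosedX : ∀ φ : P ≃ₜ* P, IsClosed ((X.inertia φ : Subgroup (GQp p × P)) : Set (GQp p × P)) := fun φ => by
    have : ((X.inertia φ : Subgroup (GQp p × P)) : Set (GQp p × P)) = (D φ : Set _) ∩ (X.DeltaTemp : Set _) := rfl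
    rw [this]
    refine (hDclosed φ).inter ?_
    have hΔset : ((X.DeltaTemp : Subgroup (GQp p × P)) : Set (GQp p × P)) = Prod.fst ⁻¹' {1} := by
      ext x; exact hΔmem x
    rw [hΔset]
    exact isClosed_singleton.preimage continuous_fst
  refine ⟨X, r, ⟨eΔ⟩, hr, ⟨ContinuousMulEquiv.refl P⟩, fun _ => trivial, hIclosedX, ?_⟩
  -- SATURATION: `γ(I_φ ∩ Δ^temp) = I_{φ·γ'} ∩ Δ^temp` with `γ'` the transport of `γ` to `F̂₂`
  intro γ φ
  let γ' : P ≃ₜ* P := eΔ.trans (γ.trans eΔ.symm)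
  refine ⟨φ.trans γ', ?_⟩
  ext w
  rw [Subgroup.mem_map_equiv, Subgroup.mem_subgroupOf, Subgroup.mem_subgroupOf, hImem, hImem]
  -- `γ'.symm` restricted along `eΔ` is `γ.symm`
  have hw1 : (w : GQp p × P).1 = 1 := (hΔmem _).1 w.2
  have heΔw : eΔ (w : GQp p × P).2 = w := by
    apply Subtype.ext
    change ((1 : GQp p), (w : GQp p × P).2) = (w : GQp p × P)
    exact Prod.ext hw1.symm rfl
  have key : (φ.trans γ').symm (w : GQp p × P).2 =
      φ.symm ((γ.toMulEquiv.symm w : X.DeltaTemp) : GQp p × P).2 := by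
    change φ.symm (eΔ.symm (γ.symm (eΔ.symm.symm (w : GQp p × P).2))) = _
    rw [ContinuousMulEquiv.symm_symm, heΔw]
    rfl
  rw [key]


end TemperedCurve

end Literature.AnabelianGeometry.SemiGraphs

end
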